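import Literature.AlgebraicGeometry.Motives.MotivatedCyclesAbelianPencilPieces
import Literature.AlgebraicGeometry.Motives.ConstantFamilyFibre
import Literature.AlgebraicGeometry.Motives.AbelianVarietyExistence
import Literature.AlgebraicGeometry.Motives.AlbaneseByMaximality
import Literature.AlgebraicGeometry.Motives.VarietiesUnitProofs
import Literature.AlgebraicGeometry.Motives.VarietiesProjectiveSpaceProofs
import HarnessLib

/-!
# Constant pencils `pr₂ : A ×ₖ C ⟶ C` are compact pencils of abelian varieties; pencils exist

Y. André, *Pour une théorie inconditionnelle des motifs*, Publ. Math. IHÉS 83 (1996), §6.3,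
footnote (2) (p. 31) defines a compact pencil of (complex) abelian varieties as «un schéma abélien
de base une courbe projective lisse»; the tree renders this as the structure
`Motives.IsCompactAbelianPencil f d` (`Motives/MotivatedCyclesAbelianPencilPieces.lean`: a section,
smooth projective base curve, smooth projective total space of dimension `d + 1`,
`IsSmoothProjectiveFamily f d`, every rational fibre isomorphic to the underlying variety of an
abelian variety). This file supplies its first Literature-side inhabitants — the validation
theorem V-B15 of the Layer-B definitions tribunal of lane `lit-hodgefound` (TRIBUNAL-B row B12:
«`∃ Y C f, IsCompactAbelianPencil f 1` — the constant elliptic pencil `E × C → C`»), over an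
arbitrary field `k`:

* `isCompactAbelianPencil_snd` — for an abelian variety `A` and a smooth projective curve `C` over
  `k`, the constant pencil `pr₂ : A.X ×ₖ C ⟶ C` is a compact pencil of abelian varieties of relative
  dimension `dim A`: section `(0_A, 𝟙_C)`; total space smooth projective of dimension `dim A + 1`
  (`IsSmoothProjective.tensor_holds`, Segre); `pr₂` a smooth projective family (base change of
  `A → Spec k`, `isSmoothProjectiveFamily_snd`, Hartshorne III Prop. 10.1 (b)); every rational fibre
  `≅ A.X` by the slice isomorphism `sliceFiberIso` (Hartshorne II.3);
* `isCompactAbelianPencil_snd_projectiveLine` — the isotrivial pencil `A × ℙ¹ ⟶ ℙ¹`;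
* `exists_isCompactAbelianPencil_one` — **V-B15**: over every field there is a compact pencil of
  abelian varieties of relative dimension `1`, namely `E × E ⟶ E` for the elliptic curve
  `E = E_{W}`, `W = WeierstrassCurve.ofJ 37`, of `exists_abelianVariety_dim_eq_one`;
* `exists_isCompactAbelianPencil` — likewise in every relative dimension `d` (`A × E ⟶ E` with
  `dim A = d`, `exists_abelianVariety_dim_eq_succ`; `d = 0` by the trivial abelian variety);
* `compactAbelianPencilSpaces_nonempty` — hence the class of total spaces of compact abelian
  pencils (`compactAbelianPencilSpaces k`), one of the two generators of André's base pieces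
  `abelianPencilPieces k` of Théorème 0.6.2, is non-empty.

Scope. These are the CONSTANT (isotrivial) pencils only; the pencils André's proof uses
(Lemme 6.3.1, 6.3.3: linear sections of Baily–Borel compactified families of Hodge type) are not
constructed here. A Summit-side twin of `isCompactAbelianPencil_snd` over `ℂ` exists in
`Summits/HodgeConjecture/HodgeConjecture/Theorems/Ring2AbelianAllConstantPencils.lean`
(not importable from `Literature/`); the present file is its field-general Literature form, built
on the Literature slice isomorphism `Motives.sliceFiberIso` instead of an existential chart.

## References

* [Andre1996Motifs] Y. André, *Pour une théorie inconditionnelle des motifs*, Publ. Math. IHÉS 83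
  (1996), §6.3 footnote (2) (p. 31), Lemme 6.3.1 (p. 31), Thm. 0.6.2 (p. 9).
* [Hartshorne1977] R. Hartshorne, *Algebraic Geometry*, GTM 52, II.3 (p. 89, fibre of a morphism),
  III Prop. 10.1 (b) (base change of smooth morphisms), II Cor. 4.8 (c) (base change of proper
  morphisms), II Ex. 5.11 (Segre embedding).
* [SilvermanAEC2009] J. H. Silverman, *The Arithmetic of Elliptic Curves*, 2nd ed., III.3.1 (c),
  III.3.6 (elliptic curves are abelian varieties of dimension one).
-/

universe u

open CategoryTheory AlgebraicGeometry MonoidalCategory CartesianMonoidalCategory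

noncomputable section

namespace Literature.AlgebraicGeometry.Motives

variable {k : Type u} [Field k]

/-! ### The constant pencil of an abelian variety over a smooth projective curve -/

/-- **The constant pencil `pr₂ : A ×ₖ C ⟶ C` is a compact pencil of abelian varieties of relative
dimension `dim A`** (André 1996 §6.3 footnote (2): «un schéma abélien de base une courbe
projective lisse», in the tree's rendering `IsCompactAbelianPencil`), for `A` an abelian variety
and `C` a smooth projective curve over a field `k`: the section is `(0_A, 𝟙_C)`, the base is `C`,
the total space `A ×ₖ C` is smooth projective of dimension `dim A + 1` (Segre;
`IsSmoothProjective.tensor_holds`), `pr₂` is smooth of relative dimension `dim A` and proper (base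
change of `A → Spec k`; `isSmoothProjectiveFamily_snd`), and every rational fibre is isomorphic to
`A.X` (slice isomorphism `sliceFiberIso`). [cite: Andre1996Motifs, §6.3 footnote (2) (p. 31)] [cite: Hartshorne1977, III Prop. 10.1 (b) and II.3 (p. 89)] -/
theorem isCompactAbelianPencil_snd (A : AbelianVariety k) {C : SchemeOver k}
    (hC : IsSmoothProjective 1 C) : IsCompactAbelianPencil (snd A.X C) A.dim :=
  have hA : IsSmoothProjective A.dim A.X := AbelianVariety.isSmoothProjective_holds
  .of_section (lift (toSpecOver C ≫ (1 : A.Points k)) (𝟙 C)) (lift_snd _ _) hC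
    (IsSmoothProjective.tensor_holds hA hC) (isSmoothProjectiveFamily_snd hA C)
    fun s ↦ ⟨A, ⟨sliceFiberIso A.X s⟩⟩

/-- The constant pencil `pr₂ : A ×ₖ C ⟶ C` in the typing `dim A = d`: a compact pencil of abelian
varieties of relative dimension `d`. [cite: Andre1996Motifs, §6.3 footnote (2) (p. 31)] -/
theorem isCompactAbelianPencil_snd_of_dim_eq (A : AbelianVariety k) {d : ℕ} (hd : A.dim = d)
    {C : SchemeOver k} (hC : IsSmoothProjective 1 C) : IsCompactAbelianPencil (snd A.X C) d :=
  hd ▸ isCompactAbelianPencil_snd A hC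

/-- **The isotrivial pencil `pr₂ : A ×ₖ ℙ¹ ⟶ ℙ¹`** over the projective line is a compact pencil of
abelian varieties of relative dimension `dim A` (`ℙ¹_k` is a smooth projective curve,
`isSmoothProjective_projectiveSpace_holds`). [cite: Andre1996Motifs, §6.3 footnote (2) (p. 31)] [cite: Hartshorne1977, II.4.8 and III.10.1 (ℙⁿ smooth projective)] -/
theorem isCompactAbelianPencil_snd_projectiveLine (A : AbelianVariety k) :
    IsCompactAbelianPencil (snd A.X (projectiveSpace 1 k)) A.dim :=
  isCompactAbelianPencil_snd A (isSmoothProjective_projectiveSpace_holds k 1)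

/-- The total space `A ×ₖ C` of a constant pencil over a smooth projective curve is a member of
the class `compactAbelianPencilSpaces k` of total spaces of compact abelian pencils (André 1996
Thm. 0.6.2: «`Yᵢ` l'espace total d'un pinceau compact de variétés abéliennes»).
[cite: Andre1996Motifs, Thm. 0.6.2 (p. 9) and §6.3 footnote (2) (p. 31)] -/
theorem tensor_mem_compactAbelianPencilSpaces (A : AbelianVariety k) {C : SchemeOver k}
    (hC : IsSmoothProjective 1 C) : A.X ⊗ C ∈ compactAbelianPencilSpaces k :=
  ⟨A.dim, C, snd A.X C, isCompactAbelianPencil_snd A hC⟩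

/-! ### Existence: V-B15 and every relative dimension -/

/-- **An elliptic curve over itself: `pr₂ : E ×ₖ E ⟶ E` is a compact pencil of abelian varieties of
relative dimension `1`** for every abelian variety `E` of dimension `1` (the base `E.X` is then a
smooth projective curve, `AbelianVariety.isSmoothProjective_holds`).
[cite: Andre1996Motifs, §6.3 footnote (2) (p. 31)] [cite: SilvermanAEC2009, III.3.1 (c) and III.3.6] -/
theorem isCompactAbelianPencil_snd_self_of_dim_eq_one (E : AbelianVariety k) (hE : E.dim = 1) :
    IsCompactAbelianPencil (snd E.X E.X) 1 :=
  have h1 : IsSmoothProjective E.dim E.X := AbelianVariety.isSmoothProjective_holds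
  isCompactAbelianPencil_snd_of_dim_eq E hE (hE ▸ h1)

variable (k)

/-- **V-B15 (non-vacuity of `IsCompactAbelianPencil` in relative dimension `1`).** Over every field
`k` there are `k`-schemes `Y`, `C` and a morphism `f : Y ⟶ C` forming a compact pencil of abelian
varieties of relative dimension `1`: the constant elliptic pencil `pr₂ : E ×ₖ E ⟶ E` of the
elliptic curve `E` of `exists_abelianVariety_dim_eq_one` (the plane cubic of
`WeierstrassCurve.ofJ 37` with the chord–tangent law). For `k = ℂ` this is the validation theorem
requested by the Layer-B definitions tribunal (probe `exists_isCompactAbelianPencil_req`):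
`exists_isCompactAbelianPencil_one ℂ`.
[cite: Andre1996Motifs, §6.3 footnote (2) (p. 31) and Lemme 6.3.1] [cite: SilvermanAEC2009, III.3.6] -/
theorem exists_isCompactAbelianPencil_one :
    ∃ (Y C : SchemeOver k) (f : Y ⟶ C), IsCompactAbelianPencil f 1 := by
  obtain ⟨E, hE⟩ := exists_abelianVariety_dim_eq_one k
  exact ⟨_, _, snd E.X E.X, isCompactAbelianPencil_snd_self_of_dim_eq_one E hE⟩

/-- **Compact pencils of abelian varieties exist in every relative dimension `d`** over every
field: `pr₂ : A ×ₖ E ⟶ E` with `E` an elliptic curve and `A` an abelian variety of dimension `d`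
(`exists_abelianVariety_dim_eq_succ` for `d ≥ 1`; the trivial abelian variety `Spec k`, of
dimension `0` by `schemeDim_eq_holds` on `isSmoothProjective_unit_holds`, for `d = 0`).
[cite: Andre1996Motifs, §6.3 footnote (2) (p. 31)] [cite: SilvermanAEC2009, III.3.6] -/
theorem exists_isCompactAbelianPencil (d : ℕ) :
    ∃ (Y C : SchemeOver k) (f : Y ⟶ C), IsCompactAbelianPencil f d := by
  obtain ⟨E, hE⟩ := exists_abelianVariety_dim_eq_one k
  have hC : IsSmoothProjective 1 E.X := hE ▸ AbelianVariety.isSmoothProjective_holds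
  obtain ⟨A, hA⟩ : ∃ A : AbelianVariety k, A.dim = d := by
    cases d with
    | zero => exact ⟨AbelianVariety.trivial k, schemeDim_eq_holds (isSmoothProjective_unit_holds (k := k))⟩
    | succ d => exact exists_abelianVariety_dim_eq_succ k d
  exact ⟨_, _, snd A.X E.X, isCompactAbelianPencil_snd_of_dim_eq A hA hC⟩

/-- **The class of total spaces of compact abelian pencils is non-empty** over every field (it
contains `E ×ₖ E` for an elliptic curve `E`); hence André's base pieces `abelianPencilPieces k`
have members of pencil type, not only abelian varieties.
[cite: Andre1996Motifs, Thm. 0.6.2 (p. 9) and §6.3 footnote (2) (p. 31)] -/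
theorem compactAbelianPencilSpaces_nonempty : (compactAbelianPencilSpaces k).Nonempty := by
  obtain ⟨Y, C, f, hf⟩ := exists_isCompactAbelianPencil_one k
  exact ⟨Y, 1, C, f, hf⟩

end Literature.AlgebraicGeometry.Motives

end
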